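import Literature.Probability.Percolation.FourArmSeparationFacts
import Literature.Probability.Percolation.NearCriticalFourArmSeparation
import HarnessLib

/-!
# Werner's Lemma 6.2 (`Werner2009_lemma62`) from the two named displays of Nolin's four-arm
# separation theorem (assembled discharge; proofs only)

Topic `Literature/Probability/Percolation`; family `crit-perc`. PROOFS ONLY (no definition, no named
fact). FACT DECOMPOSITION (librarian, 2026-08-16, unit `libsplit-17`) of the capped named fact
`Literature.Probability.Percolation.Werner2009_lemma62` (`KestenRelationRusso.lean`; W. Werner,
*Lectures on two-dimensional critical percolation*, IAS/Park City Math. Ser. 16 (2009), Lecture 6,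
Lemma 6.2: "Uniformly for `n ≤ L(p)`, `d/dp h_p(n) ≍ n² π̂_p(n)`", rhombus form with the critical
`π₄` as in Nolin 2008, Remark 35).

Its children already exist: the two displays of Nolin's arm-separation theorem for four arms
(P. Nolin, EJP 13 (2008), Thm. 11 [arXiv 0711.4948: Thm. 10], `j = 4`) named today by the
decomposition of crit-perc.S16 in `FourArmSeparationFacts.lean` —
`Nolin2008_altFourArm_separation` (`σ = BWBW`, uniformly below `L(p)`; a byte-identical copy
`Nolin2008_altFourArm_separation_nearCritical` was landed minutes later by the decomposition of
`Werner2009_oneArm_nearCritical`, `AltFourArmSeparationNearCritical.lean`, and is due to become a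
deprecated alias of this one) and `Nolin2008_adjFourArm_landing` (`σ = BBWW` at `p = 1/2`). The
in-tree reduction `Werner2009_lemma62_of_altSeparation_of_landing`
(`KestenRelationRussoFromTwoDisplays.lean`) consumes exactly these two displays, everything else in
Werner's proof — the a priori alternating four-arm lower bound `altFourArm_lowerBound`, Lemma 6.3
from separation `altFourArm_stability_of_altSeparation`, the critical bridge
`fourArm_bridge_of_landing` with Smirnov's colour switching `fourArm_flip`, Russo's formula and the
pivotal bookkeeping of `KestenRelationRussoAlt` / `KestenRelationRussoFromAltSeparation` — being
proved. This file records the assembly BY NAME; the discharge is the one-liner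
`Werner2009_lemma62_holds_of Nolin2008_altFourArm_separation_holds Nolin2008_adjFourArm_landing_holds`
once Nolin's theorem is proved for four arms (its `j = 2` instance `Nolin2008_twoArm_separation_holds`
is a theorem of the tree). The sibling capped fact `Werner2009_oneArm_logDeriv` already has its
assembly `Werner2009_oneArm_logDeriv_holds_of` (`AltFourArmSeparationNearCritical.lean`).

Glue between the parallel decompositions of 2026-08-16: the ORDER-FREE near-critical separation
fact `Werner2009_fourArm_separation` (`NearCriticalFourArmSeparation.lean`, decomposition of
`Werner2009_lemma62P`: `c · π̂_t(n, N) ≤ P_t(sepFourArm n N)` with the order-free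
`π̂ = fourArmProbAt`) implies the alternating display `Nolin2008_altFourArm_separation` outright,
because `π̂^alt ≤ π̂` (`altFourArmProbAt_le_fourArmProbAt`): `Nolin2008_altFourArm_separation_of_fourArm_separation`.
Hence ONE proof of Nolin's Thm. 11 for `j = 4` in the order-free form closes every consumer of
either display, and `Werner2009_lemma62` follows from the order-free fact and the landing display
(`Werner2009_lemma62_holds_of'`).

## References

* W. Werner, *Lectures on two-dimensional critical percolation*, IAS/Park City Math. Ser. 16
  (2009) = arXiv:0710.0856, Lecture 6, §3, Prop. 6.1, Cor. 6.1–6.2, Lemma 6.2–6.3. [WernerPCMI2009]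
* P. Nolin, *Near-critical percolation in two dimensions*, Electron. J. Probab. 13 (2008)
  1562–1623 = arXiv:0711.4948, §4.3 Thm. 11, §5.1 Prop. 20, §7.3 Prop. 34 and Remark 35.
  [Nolin2008]
-/

noncomputable section

namespace Literature.Probability.Percolation

/-- **Werner's Lemma 6.2 for the rhombus (`Werner2009_lemma62`) from the two named displays of
Nolin's Thm. 11** (`Nolin2008_altFourArm_separation`, `Nolin2008_adjFourArm_landing`): the tree's
`Werner2009_lemma62_of_altSeparation_of_landing`. [cite: WernerPCMI2009, Lecture 6, Lemma 6.2 with Lemma 6.3, Prop. 6.1 and Cor. 6.1–6.2]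
[cite: Nolin2008, Thm. 11 (j = 4, σ = BWBW and σ = BBWW; arXiv 0711.4948: Thm. 10), §5.1 Prop. 20, §7.3 Prop. 34 and Remark 35] -/
theorem Werner2009_lemma62_holds_of (hsep : Nolin2008_altFourArm_separation)
    (hland : Nolin2008_adjFourArm_landing) : Werner2009_lemma62 :=
  Werner2009_lemma62_of_altSeparation_of_landing hsep hland

/-- **Order-free near-critical four-arm separation implies the alternating display**: if
`c · π̂_t(n, N) ≤ P_t(sepFourArm n N)` with the order-free `π̂ = fourArmProbAt`
(`Werner2009_fourArm_separation`), then the same holds with Werner's alternating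
`π̂^alt = altFourArmProbAt ≤ π̂` (`altFourArmProbAt_le_fourArmProbAt`), i.e.
`Nolin2008_altFourArm_separation`, with the same `ε₁, n₀, δ, c`. [cite: Nolin2008, Thm. 11 (j = 4; arXiv 0711.4948: Thm. 10)] -/
theorem Nolin2008_altFourArm_separation_of_fourArm_separation (h : Werner2009_fourArm_separation) :
    Nolin2008_altFourArm_separation := by
  obtain ⟨ε₁, hε₁, h⟩ := h
  refine ⟨ε₁, hε₁, ?_⟩
  intro ε hε hεε
  obtain ⟨n₀, δ, hδ, c, hc, hq⟩ := h hε hεε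
  refine ⟨n₀, δ, hδ, c, hc, fun t ht ht' n N hn hnN hL => ?_⟩
  exact (mul_le_mul_of_nonneg_left (altFourArmProbAt_le_fourArmProbAt t n N) hc.le).trans
    (hq t ht ht' n N hn hnN hL)

/-- **`Werner2009_lemma62` from the order-free separation fact and the landing display**:
`Werner2009_lemma62_holds_of` through `Nolin2008_altFourArm_separation_of_fourArm_separation`.
[cite: WernerPCMI2009, Lecture 6, Lemma 6.2 with Prop. 6.1] [cite: Nolin2008, Thm. 11 (j = 4) and §5.1 Prop. 20 (arXiv 0711.4948: Thm. 10, Prop. 19)] -/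
theorem Werner2009_lemma62_holds_of' (hsep : Werner2009_fourArm_separation)
    (hland : Nolin2008_adjFourArm_landing) : Werner2009_lemma62 :=
  Werner2009_lemma62_holds_of (Nolin2008_altFourArm_separation_of_fourArm_separation hsep) hland

end Literature.Probability.Percolation

end
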